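import Summits.CriticalPhenomena.PercolationContinuityZ3.Theorems.PercNearOneGluingNoHeavyLowerTailMajorityGluingTypeTableBottomB1W1
import Summits.CriticalPhenomena.PercolationContinuityZ3.Theorems.PercNearOneGluingNoHeavyLowerTailMajorityGluingTypeTableBottomB1W2
import Summits.CriticalPhenomena.PercolationContinuityZ3.Theorems.PercNearOneGluingNoHeavyLowerTailMajorityGluingTypeTableBottomB1W3
import Summits.CriticalPhenomena.PercolationContinuityZ3.Theorems.PercNearOneGluingNoHeavyLowerTailMajorityGluingTypeTableBottomB1W4
import Summits.CriticalPhenomena.PercolationContinuityZ3.Theorems.PercNearOneGluingNoHeavyLowerTailMajorityGluingTypeTableStarCertificates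
import HarnessLib

/-!
# THEOREM BOTTOM of the abstract `(4,3)` programme, assembled (lane prim-rate, constants-miner 1, gen 27; BENCH l.222)

Support file for the closed crux `NoHeavyLowerTail` (stmt-CriticalPhenomena-4575), majority-gluing line.  Puts together
`bottom_regime_AB2` and `bottom_regime_B1_w{1,2,3,4}`: for every nonnegative law on the 94 types satisfying the
budgets, the scale-free normalisation, the ten ISO₃ rows (six hub triples, four relay triples, canonical listing), ISO₄
in profile form, and the four STAR_w θ-form implications,
`E(x) ≤ max{2(6^{c₃}·25)^{1/(c₃−2)}·M^{√3}, (1/14)((6(1+4^{1/c₃}))^{c₃})^{1/(c₃−2)}·M^{√3}, (2^{c₄}·4320)^{1/(2c₄−4)}·M^{(4−c₄)/(2c₄−4)}}`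
— THEOREM BOTTOM of CLEAN-CERTIFICATES §8 with its constants in closed form (`1.41·10⁹`, `5.9·10⁶`, `6.06·10⁴`;
exponents `√3`, `√3`, `κ₀/(2−4p) = 1.6861`).  The relay-triple rows are converted between listing orders by the
permutation invariance of `u_S` and `ρ_t^S` (`iso_perm12/23`).  `bottom_rows` is the same theorem with the four STAR_w
θ-forms discharged by `star{w}_theta` (…TypeTableStarCertificates), i.e. with ROWS ONLY as hypotheses: budgets, normalisation,
STAR's 13 linear rows, the 6 hub-pair and 12 relay-root van den Berg–Kahn rows (reduced form), 10 ISO₃ rows, ISO₄.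
No definitions, no sorries.
[cite: VandenbergHaggstromKahn2005, Thm. 1.3 (p. 6)]
-/

namespace Summit.CriticalPhenomena.PercolationContinuityZ3.Theorems

namespace HubOnly
namespace TypeTable

noncomputable section
open DType

/-! ### THEOREM BOTTOM assembled (CLEAN-CERTIFICATES §8, BENCH l.222 M1-BOTTOM) -/

/-- A relay-triple isolation row is invariant under swapping the first two listed points. -/
theorem iso_perm12 (x : DType → ℝ) {c m : ℝ} {a b d : ℕ} (ha : a ∈ [0, 1, 2, 3, 4]) (hb : b ∈ [0, 1, 2, 3, 4])
    (hd : d ∈ [0, 1, 2, 3, 4])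
    (h : uS [a, b, d] x ^ c ≤ m * lin (fun τ => ind (τ.rho [a, b, d] a)) x *
      lin (fun τ => ind (τ.rho [a, b, d] b)) x * lin (fun τ => ind (τ.rho [a, b, d] d)) x) :
    uS [b, a, d] x ^ c ≤ m * lin (fun τ => ind (τ.rho [b, a, d] b)) x *
      lin (fun τ => ind (τ.rho [b, a, d] a)) x * lin (fun τ => ind (τ.rho [b, a, d] d)) x := by
  have hu : uS [b, a, d] x = uS [a, b, d] x :=
    lin_congr (fun τ hτ => by simp only [DType.uZ, (uB_perm3 τ hτ a ha b hb d hd).1]) x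
  have hr : ∀ t : ℕ, lin (fun τ => ind (τ.rho [b, a, d] t)) x = lin (fun τ => ind (τ.rho [a, b, d] t)) x :=
    fun t => lin_congr (fun τ hτ => by simp only [(rho_perm3 τ hτ a ha b hb d hd).1 t]) x
  rw [hu, hr, hr, hr]
  exact h.trans (le_of_eq (by ring))

/-- A relay-triple isolation row is invariant under swapping the last two listed points. -/
theorem iso_perm23 (x : DType → ℝ) {c m : ℝ} {a b d : ℕ} (ha : a ∈ [0, 1, 2, 3, 4]) (hb : b ∈ [0, 1, 2, 3, 4])
    (hd : d ∈ [0, 1, 2, 3, 4])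
    (h : uS [a, b, d] x ^ c ≤ m * lin (fun τ => ind (τ.rho [a, b, d] a)) x *
      lin (fun τ => ind (τ.rho [a, b, d] b)) x * lin (fun τ => ind (τ.rho [a, b, d] d)) x) :
    uS [a, d, b] x ^ c ≤ m * lin (fun τ => ind (τ.rho [a, d, b] a)) x *
      lin (fun τ => ind (τ.rho [a, d, b] d)) x * lin (fun τ => ind (τ.rho [a, d, b] b)) x := by
  have hu : uS [a, d, b] x = uS [a, b, d] x :=
    lin_congr (fun τ hτ => by simp only [DType.uZ, (uB_perm3 τ hτ a ha b hb d hd).2]) x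
  have hr : ∀ t : ℕ, lin (fun τ => ind (τ.rho [a, d, b] t)) x = lin (fun τ => ind (τ.rho [a, b, d] t)) x :=
    fun t => lin_congr (fun τ hτ => by simp only [(rho_perm3 τ hτ a ha b hb d hd).2 t]) x
  rw [hu, hr, hr, hr]
  exact h.trans (le_of_eq (by ring))

/-- Some relay carries the largest layer `T_w = T_max`. -/
theorem exists_dominant (x : DType → ℝ) : ∃ w ∈ [1, 2, 3, 4], ∀ z ∈ [1, 2, 3, 4], Tm z x ≤ Tm w x := by
  have key : ∀ w ∈ [1, 2, 3, 4], max (max (Tm 1 x) (Tm 2 x)) (max (Tm 3 x) (Tm 4 x)) = Tm w x →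
      ∃ w ∈ [1, 2, 3, 4], ∀ z ∈ [1, 2, 3, 4], Tm z x ≤ Tm w x := by
    intro w hw he
    refine ⟨w, hw, fun z hz => ?_⟩
    rw [← he]
    simp only [List.mem_cons, List.not_mem_nil, or_false] at hz
    rcases hz with rfl | rfl | rfl | rfl
    · exact (le_max_left _ _).trans (le_max_left _ _)
    · exact (le_max_right _ _).trans (le_max_left _ _)
    · exact (le_max_left _ _).trans (le_max_right _ _)
    · exact (le_max_right _ _).trans (le_max_right _ _)
  rcases max_choice (max (Tm 1 x) (Tm 2 x)) (max (Tm 3 x) (Tm 4 x)) with h | h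
  · rcases max_choice (Tm 1 x) (Tm 2 x) with h' | h'
    · exact key 1 (by simp) (by rw [h, h'])
    · exact key 2 (by simp) (by rw [h, h'])
  · rcases max_choice (Tm 3 x) (Tm 4 x) with h' | h'
    · exact key 3 (by simp) (by rw [h, h'])
    · exact key 4 (by simp) (by rw [h, h'])

/-- **THEOREM BOTTOM (mine-1 gen 24, CLEAN-CERTIFICATES §8, BENCH l.222; the asymptotic bottom bound of the abstract
route).**  Let `x ≥ 0` be a law on the 94 types with: the budgets `B₂, B₃, B₄`; the scale-free normalisation
`x(v₁ cut) ≤ 1`; the six hub-triple and the four relay-triple isolation rows ISO₃ in scale-free form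
`u_S^{c₃} ≤ M^{3−c₃}·Π_{t∈S} ρ_t^S` (`c₃ = (3+√3)/2`; for a hub triple `ρ₀ = x(v_a, v_b cut)` and `ρ_a = π_{a¬b}`);
ISO₄ in the profile form `u₁₂₃₄^{c₄} ≤ M^{4−c₄}·Π_z (S_z + T_z)` (`c₄ = (3+√(11/3))/2`); and for each relay `w` the
STAR_w θ-form with `θ = ½` as an implication (discharged by `star{w}_theta` of `…TypeTableStarCertificates` from
STAR_w's linear rows and the three hub-pair / three relay-root van den Berg–Kahn rows of `w`).  Then
`E(x) = E f/δ₁ − 1 ≤ max{ 2(6^{c₃}·25)^{1/(c₃−2)}·M^{√3}, (1/14)((6(1+4^{1/c₃}))^{c₃})^{1/(c₃−2)}·M^{√3},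
(2^{c₄}·4320)^{1/(2c₄−4)}·M^{(4−c₄)/(2c₄−4)} }` — numerically `max{1.41·10⁹·M^{1.7321}, 5.9·10⁶·M^{1.7321},
6.06·10⁴·M^{1.6861}}`: `sup E = O(M^{1.686})` as `M → 0`, the bottom statement of the abstract route (regimes A/B2
by `bottom_regime_AB2`, regime B1 by `bottom_regime_B1_w{1..4}` for the dominant relay). -/
theorem bottom (x : DType → ℝ) (hx : ∀ τ, 0 ≤ x τ) {M : ℝ} (hM : 0 < M)
    (hB2 : lin (fun τ => τ.bud 2) x ≤ 0) (hB3 : lin (fun τ => τ.bud 3) x ≤ 0)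
    (hB4 : lin (fun τ => τ.bud 4) x ≤ 0) (hnorm : lin (fun τ => τ.cutZ 1) x ≤ 1)
    (isoH : ∀ a ∈ [1, 2, 3, 4], ∀ b ∈ [1, 2, 3, 4], a < b →
      uS [0, a, b] x ^ ((3 + Real.sqrt 3) / 2) ≤
        M ^ (3 - (3 + Real.sqrt 3) / 2) * Rho0 a b x * Pim a b x * Pim b a x)
    (isoR : ∀ a ∈ [1, 2, 3, 4], ∀ b ∈ [1, 2, 3, 4], ∀ c ∈ [1, 2, 3, 4], a < b → b < c →
      uS [a, b, c] x ^ ((3 + Real.sqrt 3) / 2) ≤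
        M ^ (3 - (3 + Real.sqrt 3) / 2) * lin (fun τ => ind (τ.rho [a, b, c] a)) x *
          lin (fun τ => ind (τ.rho [a, b, c] b)) x * lin (fun τ => ind (τ.rho [a, b, c] c)) x)
    (iso4 : uS [1, 2, 3, 4] x ^ ((3 + Real.sqrt (11 / 3)) / 2) ≤
      M ^ (4 - (3 + Real.sqrt (11 / 3)) / 2) * (Sm 1 x + Tm 1 x) * (Sm 2 x + Tm 2 x) * (Sm 3 x + Tm 3 x)
        * (Sm 4 x + Tm 4 x))
    (hstar1 : 0 < Tm 1 x → Sm 1 x ≤ (2 - 1 / 2) * Tm 1 x →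
      ACm x * (3 * E x) ≤ ACm x * uS [1, 2, 3, 4] x - 1 / 2 * (Tm 1 x * (Tm 2 x + Tm 3 x + Tm 4 x)))
    (hstar2 : 0 < Tm 2 x → Sm 2 x ≤ (2 - 1 / 2) * Tm 2 x →
      ACm x * (3 * E x) ≤ ACm x * uS [1, 2, 3, 4] x - 1 / 2 * (Tm 2 x * (Tm 1 x + Tm 3 x + Tm 4 x)))
    (hstar3 : 0 < Tm 3 x → Sm 3 x ≤ (2 - 1 / 2) * Tm 3 x →
      ACm x * (3 * E x) ≤ ACm x * uS [1, 2, 3, 4] x - 1 / 2 * (Tm 3 x * (Tm 1 x + Tm 2 x + Tm 4 x)))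
    (hstar4 : 0 < Tm 4 x → Sm 4 x ≤ (2 - 1 / 2) * Tm 4 x →
      ACm x * (3 * E x) ≤ ACm x * uS [1, 2, 3, 4] x - 1 / 2 * (Tm 4 x * (Tm 1 x + Tm 2 x + Tm 3 x))) :
    E x ≤ max (2 * ((6 : ℝ) ^ ((3 + Real.sqrt 3) / 2) * 25) ^ ((3 + Real.sqrt 3) / 2 - 2)⁻¹ * M ^ Real.sqrt 3)
      (max ((1 / 14) * (((6 * (1 + (4 : ℝ) ^ ((3 + Real.sqrt 3) / 2)⁻¹)) ^ ((3 + Real.sqrt 3) / 2)) ^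
          ((3 + Real.sqrt 3) / 2 - 2)⁻¹ * M ^ Real.sqrt 3))
        (((2 : ℝ) ^ ((3 + Real.sqrt (11 / 3)) / 2) * 4320) ^ (2 * ((3 + Real.sqrt (11 / 3)) / 2) - 4)⁻¹ *
          M ^ ((4 - (3 + Real.sqrt (11 / 3)) / 2) / (2 * ((3 + Real.sqrt (11 / 3)) / 2) - 4)))) := by
  have m1 : (1:ℕ) ∈ [0, 1, 2, 3, 4] := by simp
  have m2 : (2:ℕ) ∈ [0, 1, 2, 3, 4] := by simp
  have m3 : (3:ℕ) ∈ [0, 1, 2, 3, 4] := by simp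
  have m4 : (4:ℕ) ∈ [0, 1, 2, 3, 4] := by simp
  have r123 := isoR 1 (by simp) 2 (by simp) 3 (by simp) (by norm_num) (by norm_num)
  have r124 := isoR 1 (by simp) 2 (by simp) 4 (by simp) (by norm_num) (by norm_num)
  have r134 := isoR 1 (by simp) 3 (by simp) 4 (by simp) (by norm_num) (by norm_num)
  have r234 := isoR 2 (by simp) 3 (by simp) 4 (by simp) (by norm_num) (by norm_num)
  -- the relay-triple rows in the listing order `[w, a, b]` each regime-B1 theorem wants
  have r213 := iso_perm12 x m1 m2 m3 r123
  have r214 := iso_perm12 x m1 m2 m4 r124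
  have r312 := iso_perm12 x m1 m3 m2 (iso_perm23 x m1 m2 m3 r123)
  have r314 := iso_perm12 x m1 m3 m4 r134
  have r324 := iso_perm12 x m2 m3 m4 r234
  have r412 := iso_perm12 x m1 m4 m2 (iso_perm23 x m1 m2 m4 r124)
  have r413 := iso_perm12 x m1 m4 m3 (iso_perm23 x m1 m3 m4 r134)
  have r423 := iso_perm12 x m2 m4 m3 (iso_perm23 x m2 m3 m4 r234)
  obtain ⟨w, hw, hdom⟩ := exists_dominant x
  by_cases hK : Km x ≤ Tm w x / 2
  swap
  · -- regimes A / B2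
    push Not at hK
    exact le_max_of_le_left
      (bottom_regime_AB2 x hx hM hB2 hB3 hB4 hnorm isoH (fun z hz => by linarith [hdom z hz]))
  refine le_max_of_le_right ?_
  simp only [List.mem_cons, List.not_mem_nil, or_false] at hw
  rcases hw with rfl | rfl | rfl | rfl
  · refine bottom_regime_B1_w1 x hx hM hB2 hB3 hB4 hnorm ?_ ?_ iso4 hstar1 hdom hK
    · intro a ha b hb hab
      exact isoH a (mem_relays_of_mem3 (by simp) (by simp) (by simp) ha) b (mem_relays_of_mem3 (by simp) (by simp) (by simp) hb) hab
    · intro a ha b hb hab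
      simp only [List.mem_cons, List.not_mem_nil, or_false] at ha hb
      rcases ha with rfl | rfl | rfl <;> rcases hb with rfl | rfl | rfl
      all_goals first | (exfalso; omega) | skip
      · exact r123
      · exact r124
      · exact r134
  · refine bottom_regime_B1_w2 x hx hM hB2 hB3 hB4 hnorm ?_ ?_ (iso4.trans (le_of_eq (by ring))) hstar2 hdom hK
    · intro a ha b hb hab
      exact isoH a (mem_relays_of_mem3 (by simp) (by simp) (by simp) ha) b (mem_relays_of_mem3 (by simp) (by simp) (by simp) hb) hab
    · intro a ha b hb hab
      simp only [List.mem_cons, List.not_mem_nil, or_false] at ha hb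
      rcases ha with rfl | rfl | rfl <;> rcases hb with rfl | rfl | rfl
      all_goals first | (exfalso; omega) | skip
      · exact r213
      · exact r214
      · exact r234
  · refine bottom_regime_B1_w3 x hx hM hB2 hB3 hB4 hnorm ?_ ?_ (iso4.trans (le_of_eq (by ring))) hstar3 hdom hK
    · intro a ha b hb hab
      exact isoH a (mem_relays_of_mem3 (by simp) (by simp) (by simp) ha) b (mem_relays_of_mem3 (by simp) (by simp) (by simp) hb) hab
    · intro a ha b hb hab
      simp only [List.mem_cons, List.not_mem_nil, or_false] at ha hb
      rcases ha with rfl | rfl | rfl <;> rcases hb with rfl | rfl | rfl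
      all_goals first | (exfalso; omega) | skip
      · exact r312
      · exact r314
      · exact r324
  · refine bottom_regime_B1_w4 x hx hM hB2 hB3 hB4 hnorm ?_ ?_ (iso4.trans (le_of_eq (by ring))) hstar4 hdom hK
    · intro a ha b hb hab
      exact isoH a (mem_relays_of_mem3 (by simp) (by simp) (by simp) ha) b (mem_relays_of_mem3 (by simp) (by simp) (by simp) hb) hab
    · intro a ha b hb hab
      simp only [List.mem_cons, List.not_mem_nil, or_false] at ha hb
      rcases ha with rfl | rfl | rfl <;> rcases hb with rfl | rfl | rfl
      all_goals first | (exfalso; omega) | skip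
      · exact r412
      · exact r413
      · exact r423

/-- `x(C_{ab}) = x(C_{ba})` (the hub-pair event is symmetric in the pair). -/
theorem Cm_symm (x : DType → ℝ) : ∀ a ∈ [1, 2, 3, 4], ∀ b ∈ [1, 2, 3, 4], Cm a b x = Cm b a x :=
  fun a ha b hb => lin_congr (fun τ hτ => by rw [(pair_symm τ hτ a ha b hb).1]) x

/-- **THEOREM BOTTOM from the rows** — the same statement with the four STAR_w θ-forms discharged by `star{w}_theta`:
the hypotheses are now literally rows of the programme — the budgets, the normalisation, STAR's linear rows (`B₂` and
`O_dn4_23, O_up4_23, O_dn3_24` for `w = 1`; `Cpair_xy, CaloneY_x_w, CaloneY_y_w` for `w = 2,3,4`), the six hub-pair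
van den Berg–Kahn rows `T_aT_b ≤ x(C_ab)·x(all cut)`, the twelve relay-root rows in reduced form
`(x(C_rz) + x(P_rz))·T_r ≤ x(C_rz)·(T_r + S_r)` (`relay_row_reduced`), the ten ISO₃ rows and ISO₄. -/
theorem bottom_rows (x : DType → ℝ) (hx : ∀ τ, 0 ≤ x τ) {M : ℝ} (hM : 0 < M)
    (hB2 : lin (fun τ => τ.bud 2) x ≤ 0) (hB3 : lin (fun τ => τ.bud 3) x ≤ 0)
    (hB4 : lin (fun τ => τ.bud 4) x ≤ 0) (hnorm : lin (fun τ => τ.cutZ 1) x ≤ 1)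
    (o1 : lin (fun τ => τ.odn 4 2 3) x ≤ 0) (o2 : lin (fun τ => τ.oup 4 2 3) x ≤ 0)
    (o3 : lin (fun τ => τ.odn 3 2 4) x ≤ 0)
    (c34 : lin (fun τ => τ.cpair 3 4) x ≤ 0) (y32 : lin (fun τ => τ.caloneY 3 2) x ≤ 0)
    (y42 : lin (fun τ => τ.caloneY 4 2) x ≤ 0)
    (c24 : lin (fun τ => τ.cpair 2 4) x ≤ 0) (y23 : lin (fun τ => τ.caloneY 2 3) x ≤ 0)
    (y43 : lin (fun τ => τ.caloneY 4 3) x ≤ 0)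
    (c23 : lin (fun τ => τ.cpair 2 3) x ≤ 0) (y24 : lin (fun τ => τ.caloneY 2 4) x ≤ 0)
    (y34 : lin (fun τ => τ.caloneY 3 4) x ≤ 0)
    (hub : ∀ a ∈ [1, 2, 3, 4], ∀ b ∈ [1, 2, 3, 4], a < b → Tm a x * Tm b x ≤ Cm a b x * ACm x)
    (rel : ∀ r ∈ [1, 2, 3, 4], ∀ z ∈ [1, 2, 3, 4], r ≠ z →
      (Cm r z x + Pm r z x) * Tm r x ≤ Cm r z x * (Tm r x + Sm r x))
    (isoH : ∀ a ∈ [1, 2, 3, 4], ∀ b ∈ [1, 2, 3, 4], a < b →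
      uS [0, a, b] x ^ ((3 + Real.sqrt 3) / 2) ≤
        M ^ (3 - (3 + Real.sqrt 3) / 2) * Rho0 a b x * Pim a b x * Pim b a x)
    (isoR : ∀ a ∈ [1, 2, 3, 4], ∀ b ∈ [1, 2, 3, 4], ∀ c ∈ [1, 2, 3, 4], a < b → b < c →
      uS [a, b, c] x ^ ((3 + Real.sqrt 3) / 2) ≤
        M ^ (3 - (3 + Real.sqrt 3) / 2) * lin (fun τ => ind (τ.rho [a, b, c] a)) x *
          lin (fun τ => ind (τ.rho [a, b, c] b)) x * lin (fun τ => ind (τ.rho [a, b, c] c)) x)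
    (iso4 : uS [1, 2, 3, 4] x ^ ((3 + Real.sqrt (11 / 3)) / 2) ≤
      M ^ (4 - (3 + Real.sqrt (11 / 3)) / 2) * (Sm 1 x + Tm 1 x) * (Sm 2 x + Tm 2 x) * (Sm 3 x + Tm 3 x)
        * (Sm 4 x + Tm 4 x)) :
    E x ≤ max (2 * ((6 : ℝ) ^ ((3 + Real.sqrt 3) / 2) * 25) ^ ((3 + Real.sqrt 3) / 2 - 2)⁻¹ * M ^ Real.sqrt 3)
      (max ((1 / 14) * (((6 * (1 + (4 : ℝ) ^ ((3 + Real.sqrt 3) / 2)⁻¹)) ^ ((3 + Real.sqrt 3) / 2)) ^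
          ((3 + Real.sqrt 3) / 2 - 2)⁻¹ * M ^ Real.sqrt 3))
        (((2 : ℝ) ^ ((3 + Real.sqrt (11 / 3)) / 2) * 4320) ^ (2 * ((3 + Real.sqrt (11 / 3)) / 2) - 4)⁻¹ *
          M ^ ((4 - (3 + Real.sqrt (11 / 3)) / 2) / (2 * ((3 + Real.sqrt (11 / 3)) / 2) - 4)))) := by
  have hθ : (0:ℝ) ≤ 1 / 2 := by norm_num
  have h12 := hub 1 (by simp) 2 (by simp) (by norm_num)
  have h13 := hub 1 (by simp) 3 (by simp) (by norm_num)
  have h14 := hub 1 (by simp) 4 (by simp) (by norm_num)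
  have h23 := hub 2 (by simp) 3 (by simp) (by norm_num)
  have h24 := hub 2 (by simp) 4 (by simp) (by norm_num)
  have h34 := hub 3 (by simp) 4 (by simp) (by norm_num)
  -- the flipped hub rows `T_b T_a ≤ x(C_ba) x(all cut)`
  have h21 : Tm 2 x * Tm 1 x ≤ Cm 2 1 x * ACm x := by
    rw [mul_comm (Tm 2 x), Cm_symm x 2 (by simp) 1 (by simp)]; exact h12
  have h31 : Tm 3 x * Tm 1 x ≤ Cm 3 1 x * ACm x := by
    rw [mul_comm (Tm 3 x), Cm_symm x 3 (by simp) 1 (by simp)]; exact h13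
  have h41 : Tm 4 x * Tm 1 x ≤ Cm 4 1 x * ACm x := by
    rw [mul_comm (Tm 4 x), Cm_symm x 4 (by simp) 1 (by simp)]; exact h14
  have h32 : Tm 3 x * Tm 2 x ≤ Cm 3 2 x * ACm x := by
    rw [mul_comm (Tm 3 x), Cm_symm x 3 (by simp) 2 (by simp)]; exact h23
  have h42 : Tm 4 x * Tm 2 x ≤ Cm 4 2 x * ACm x := by
    rw [mul_comm (Tm 4 x), Cm_symm x 4 (by simp) 2 (by simp)]; exact h24
  have h43 : Tm 4 x * Tm 3 x ≤ Cm 4 3 x * ACm x := by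
    rw [mul_comm (Tm 4 x), Cm_symm x 4 (by simp) 3 (by simp)]; exact h34
  refine bottom x hx hM hB2 hB3 hB4 hnorm isoH isoR iso4 ?_ ?_ ?_ ?_
  · exact fun hT hS => star1_theta x hx hθ hT hS hB2 o1 o2 o3 h12 h13 h14
      (rel 1 (by simp) 2 (by simp) (by norm_num)) (rel 1 (by simp) 3 (by simp) (by norm_num))
      (rel 1 (by simp) 4 (by simp) (by norm_num))
  · exact fun hT hS => star2_theta x hx hθ hT hS c34 y32 y42 h21 h23 h24
      (rel 2 (by simp) 1 (by simp) (by norm_num)) (rel 2 (by simp) 3 (by simp) (by norm_num))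
      (rel 2 (by simp) 4 (by simp) (by norm_num))
  · exact fun hT hS => star3_theta x hx hθ hT hS c24 y23 y43 h31 h32 h34
      (rel 3 (by simp) 1 (by simp) (by norm_num)) (rel 3 (by simp) 2 (by simp) (by norm_num))
      (rel 3 (by simp) 4 (by simp) (by norm_num))
  · exact fun hT hS => star4_theta x hx hθ hT hS c23 y24 y34 h41 h42 h43
      (rel 4 (by simp) 1 (by simp) (by norm_num)) (rel 4 (by simp) 2 (by simp) (by norm_num))
      (rel 4 (by simp) 3 (by simp) (by norm_num))

end

end TypeTable
end HubOnly

end Summit.CriticalPhenomena.PercolationContinuityZ3.Theorems
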